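import Literature.NumberTheory.EllipticCurves.KramerDescent
import Literature.NumberTheory.EllipticCurves.KramerTwoDescentLocal
import Literature.NumberTheory.EllipticCurves.KramerTwoDescentSquares
import HarnessLib

/-!
# Kramer's `2`-descent: the leaf `Kramer1983_selmerTwo_span` of `KramerDescent.lean` — PROVED

K. Kramer, *A family of semistable elliptic curves with large Tate–Shafarevitch groups*,
Proc. Amer. Math. Soc. **89** (1983), 379–386 [Kramer1983], proof of the Theorem of §5
(pp. 383–384). `KramerDescent.lean` decomposes the bound `dim Ш(B, ℚ)₂ ≥ 2n` for the
explicit family (`Kramer1983_twoRank_sha_family`) into three leaves and proves the rest; the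
third leaf, `Kramer1983_selmerTwo_span` — (7) with the containment halves of Lemma 2 and
the necessity of `(a_p)`, `(b_q)`: *for every `P ∈ A(ℚ)` the coordinates `(x + t₁, x + t₂)`
of `λ_ℚ(P)` are the classes of `a(e)`, `b(e)` for an exponent vector `e` on `{∞} ∪ 𝔏 ∪ 𝔐`
satisfying `(a_p)` for all `p ∈ 𝔏` and `(b_q)` for all `q ∈ 𝔐`* — is proved here
(`Kramer1983_selmerTwo_span_holds`), so that `Kramer1983_twoRank_sha_family` (hence the
barrier `Literature.Barriers.BirchSwinnertonDyer.TwoDescentDefectUnbounded`) rests on the two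
remaining leaves only (`Kramer1983_twoRank_sha_family_of_local_global`): the local
generators of `S(A/gB)` (Lemma 2, equality halves, over the completions) and the global map
`S(A/gB) → Ш(B, ℚ)_g ⊆ Ш(B, ℚ)₂` ((9)–(10), Galois cohomology).

Proof (elementary; pp. 383–384 read "necessity only"). For a rational point `P` let
`(d₁, d₂, d₃)` represent `λ(P) = (x + t₁, x + t₂, x + t₃)` (§3 (6); at the `2`-torsion points
the conventional values). By the local lemmas of `KramerTwoDescentValuation` /
`KramerTwoDescentLocal` this triple is *admissible* (`Admissible`, `exists_admissible`): square
product, even valuations at primes `∉ 𝔏 ∪ 𝔐` (Lemma 2 (i), (ii)), `d₂` a first-order `p`-adic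
square at `p ∈ 𝔏` (Lemma 2 (iv)), `d₃` a first-order `q`-adic square at `q ∈ 𝔐`
(Lemma 2 (iii)), `d₃ > 0`, `d₁ d₂ ≥ 0` (Lemma 2 (v)). Put `e = (sign d₁; v_p(d₁) mod 2)`
(`Admissible.exists_expo`). Comparing signs and valuation parities prime by prime
(`padicValRat_spanFst/Snd/L`, `sqClass_eq_of_even`) gives `[d₁] = [a(e)]`,
`[d₂] = [b(e)]`, `[d₃] = [c(e)]`; so `d₂ = b(e) r²` is a first-order `ℓ`-adic square for
`ℓ ∈ 𝔏`, whence `(b(e)/ℓ) = 1` (`legendreSym_eq_one_of_padicSqLike`), i.e. `(a_ℓ)`; and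
`d₃ = c(e) r′²` gives `(c(e)/q) = 1` for `q ∈ 𝔐`, i.e. `(b_q)`.

## References

* K. Kramer, Proc. Amer. Math. Soc. 89 (1983) 379–386, doi:10.1090/s0002-9939-1983-0715850-1:
  §3 (4)–(6), §4 Lemma 2 and Remark, §5 (7), (11), proof of the Theorem pp. 383–384.
  [Kramer1983] (held, read in full).
* J. H. Silverman, *The Arithmetic of Elliptic Curves*, 2nd ed. (2009), Prop. X.1.4 (complete
  `2`-descent; tree `TwoDescent`). [SilvermanAEC2009]

## Design

Namespace `Literature.NumberTheory.EllipticCurves.KramerTwoDescent` (as the two local files).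
The statements about descent components are polymorphic in the `DecidableEq ℚ` instance
carried by `twoDescentComponent`, because `kramerGamma` (an `abbrev` elaborated over an
arbitrary field under `open Classical`) carries the classical instance; the leaf is then an
instantiation (`Kramer1983_selmerTwo_span_holds`). The integral lemmas (`m : ℤ`) are applied to
`m = P.bigM` through `Int.cast_natCast`. Uses the tree's `KramerParams.primesL/primesM/badPrimes`,
`spanFst/spanSnd/spanL`, `CondA/CondB`, `KramerParams.padicValRat_finset_prod` (file
`KramerDescent`).
-/

noncomputable section

namespace Literature.NumberTheory.EllipticCurves.KramerTwoDescent

open WeierstrassCurve Affine Finset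

variable {n : ℕ} (P : KramerParams n)

/-! ### Kramer's parameters: integer divisibility forms -/

section Params

/-- `ℓ = 16m + 1` in `ℤ`. [cite: Kramer1983, Theorem (§5) (iii)] -/
theorem bigL_eq_int : ((P.bigL : ℕ) : ℤ) = 16 * (P.bigM : ℤ) + 1 := by
  rw [P.bigL_eq]; push_cast; ring

/-- `m` is odd in `ℤ`. [cite: Kramer1983, Lemma 3] -/
theorem odd_bigM_int : Odd (P.bigM : ℤ) := by
  obtain ⟨k, hk⟩ := P.odd_bigM
  exact ⟨k, by rw [hk]; push_cast; ring⟩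

/-- Members of `𝔏` divide `16m + 1` and are `≡ 1 (mod 4)`. [cite: Kramer1983, Theorem (§5) (i)–(iii)] -/
theorem dvd_of_mem_primesL {p : ℕ} (hp : p ∈ P.primesL) :
    (p : ℤ) ∣ 16 * (P.bigM : ℤ) + 1 ∧ p % 4 = 1 := by
  refine ⟨?_, P.mod_four_of_mem_primesL hp⟩
  rw [← bigL_eq_int P]
  exact_mod_cast Nat.dvd_of_mem_primeFactors (by exact hp)

/-- Members of `𝔐` divide `m` and are odd. [cite: Kramer1983, Lemma 3] -/
theorem dvd_of_mem_primesM {q : ℕ} (hq : q ∈ P.primesM) : (q : ℤ) ∣ (P.bigM : ℤ) ∧ q ≠ 2 := by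
  refine ⟨by exact_mod_cast Nat.dvd_of_mem_primeFactors (by exact hq), ?_⟩
  rintro rfl
  exact (by decide : ¬ Odd 2) (P.odd_of_mem_primesM hq)

/-- A prime outside `𝔏 ∪ 𝔐` divides neither `m` nor `16m + 1`. [folklore] -/
theorem not_dvd_of_not_mem {p : ℕ} (hp : p.Prime) (hL : p ∉ P.primesL) (hM : p ∉ P.primesM) :
    ¬ (p : ℤ) ∣ (P.bigM : ℤ) ∧ ¬ (p : ℤ) ∣ 16 * (P.bigM : ℤ) + 1 := by
  constructor
  · intro h
    exact hM (Nat.mem_primeFactors.mpr ⟨hp, by exact_mod_cast h, P.bigM_pos.ne'⟩)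
  · intro h
    rw [← bigL_eq_int P] at h
    exact hL (Nat.mem_primeFactors.mpr ⟨hp, by exact_mod_cast h, P.bigL_ne_zero⟩)

/-- The equation of `A` (11) in coordinates. [cite: Kramer1983, §5 (11)] -/
theorem curveA_equation_iff (m x y : ℚ) :
    (kramerCurveA m).toAffine.Equation x y ↔
      y ^ 2 + x * y = x ^ 3 + 8 * m * x ^ 2 + m * (16 * m + 1) * x := by
  rw [WeierstrassCurve.Affine.equation_iff]
  simp only [kramerCurveA]
  constructor <;> intro h <;> linear_combination h

end Params

/-! ### Admissible triples: the local conditions satisfied by `λ(A(ℚ))` -/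

/-- **The necessary local conditions on a descent triple.** A triple of non-zero rationals
`(d₁, d₂, d₃)` with square product (representing `λ(P) = (x + t₁, x + t₂, x + t₃)`,
§3 (4)–(6)) is *admissible* for Kramer's parameters if it satisfies the containments of
Lemma 2: even valuations at primes `∉ 𝔏 ∪ 𝔐` (Lemma 2 (i), (ii)), second coordinate a
`p`-adic square to first order at `p ∈ 𝔏` (Lemma 2 (iv), condition `(a_p)`), third
coordinate a `q`-adic square to first order at `q ∈ 𝔐` (Lemma 2 (iii), condition `(b_q)`),
third coordinate positive and the first two of the same sign (Lemma 2 (v)).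
[cite: Kramer1983, Lemma 2 and §5 (a_p), (b_q)] -/
structure Admissible (d₁ d₂ d₃ : ℚ) : Prop where
  ne₁ : d₁ ≠ 0
  ne₂ : d₂ ≠ 0
  ne₃ : d₃ ≠ 0
  sq : ∃ z : ℚ, z ^ 2 = d₁ * d₂ * d₃
  even_of_not_mem : ∀ p : ℕ, p.Prime → p ∉ P.primesL → p ∉ P.primesM →
    Even (padicValRat p d₁) ∧ Even (padicValRat p d₂) ∧ Even (padicValRat p d₃)
  sqLike₂ : ∀ p ∈ P.primesL, PadicSqLike p d₂
  sqLike₃ : ∀ q ∈ P.primesM, PadicSqLike q d₃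
  pos₃ : 0 < d₃
  nonneg₁₂ : 0 ≤ d₁ * d₂

/-! ### Every rational point gives an admissible triple -/

section PointsAdmissible

/-- Parities at `2` of the constants: `v₂(m) = v₂(16m+1) = 0`, `v₂(4) = 2`. [folklore] -/
theorem padicValRat_two_consts :
    padicValRat 2 (P.bigM : ℚ) = 0 ∧ padicValRat 2 (16 * (P.bigM : ℚ) + 1) = 0 ∧
      padicValRat 2 (4 : ℚ) = 2 := by
  have hodd := odd_bigM_int P
  have h2m : ¬ (2 : ℤ) ∣ P.bigM := by
    rw [← even_iff_two_dvd]; exact Int.not_even_iff_odd.mpr hodd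
  have h2l : ¬ ((2 : ℕ) : ℤ) ∣ 16 * (P.bigM : ℤ) + 1 := by omega
  refine ⟨?_, ?_, ?_⟩
  · have := padicValRat_intCast_eq_zero (p := 2) (z := (P.bigM : ℤ)) (by exact_mod_cast h2m)
    rwa [Int.cast_natCast] at this
  · have := padicValRat_intCast_eq_zero (p := 2) h2l
    push_cast at this; exact this
  · rw [show (4 : ℚ) = ((2 : ℕ) : ℚ) ^ 2 by norm_num, padicValRat.pow, padicValRat.self (by norm_num)]
    rfl

/-- Valuations at an odd prime outside `𝔏 ∪ 𝔐` of the same constants vanish. [folklore] -/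
theorem padicValRat_consts_of_not_mem {p : ℕ} [Fact p.Prime] (hp2 : p ≠ 2) (hL : p ∉ P.primesL)
    (hM : p ∉ P.primesM) :
    padicValRat p (P.bigM : ℚ) = 0 ∧ padicValRat p (16 * (P.bigM : ℚ) + 1) = 0 ∧
      padicValRat p (4 : ℚ) = 0 := by
  obtain ⟨hm, hl⟩ := not_dvd_of_not_mem P (Fact.out) hL hM
  refine ⟨?_, ?_, ?_⟩
  · have := padicValRat_intCast_eq_zero hm
    rwa [Int.cast_natCast] at this
  · have := padicValRat_intCast_eq_zero (p := p) hl
    push_cast at this; exact this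
  · have hp4 : ¬ (p : ℤ) ∣ 4 := by
      have h4 : ¬ p ∣ 4 := fun h4 =>
        hp2 ((Nat.prime_dvd_prime_iff_eq Fact.out Nat.prime_two).mp
          (Nat.Prime.dvd_of_dvd_pow Fact.out (show p ∣ 2 ^ 2 from h4)))
      exact_mod_cast h4
    have h4 := padicValRat_intCast_eq_zero (p := p) hp4
    rwa [show ((4 : ℤ) : ℚ) = 4 by norm_num] at h4

/-- Square-like-ness of `1`. [folklore] -/
theorem padicSqLike_one (p : ℕ) : PadicSqLike p 1 := ⟨1, Or.inl (by norm_num)⟩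

/-- `(1, 1, 1)` is admissible (the triple of the point `O`). [folklore] -/
theorem admissible_one : Admissible P 1 1 1 :=
  ⟨one_ne_zero, one_ne_zero, one_ne_zero, ⟨1, by norm_num⟩,
    fun p _ _ _ => by rw [padicValRat.one]; exact ⟨⟨0, rfl⟩, ⟨0, rfl⟩, ⟨0, rfl⟩⟩,
    fun p _ => padicSqLike_one p, fun q _ => padicSqLike_one q, one_pos, by norm_num⟩

variable {P}

/-- **`λ(A(ℚ))` satisfies the local conditions** (Lemma 2, containment halves, assembled):
for every rational affine point `(x, y)` of `A` there is an admissible triple `(d₁, d₂, d₃)`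
representing its image under the complete `2`-descent: `γ(P) = [d₁]` (`kramerGamma`, first
coordinate `x + t₁`) and `[d₂]` the second coordinate `x + t₂` (`kramerGamma₂`) — for
`x ∉ {e₁, e₂, e₃}` simply `(x, x + 4m, x + ℓ/4)`; at the `2`-torsion points the values
`(mℓ, 4m, ℓ)`, `(-4m, -m, 1)`, `(-ℓ/4, -1/4, ℓ)`. (Instance-polymorphic in `DecidableEq ℚ`, so as
to apply verbatim to `kramerGamma`, whose instance is the classical one.)
[cite: Kramer1983, Lemma 2 and §5 (p. 383: "S(A/2A) is contained in the span …")] -/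
theorem exists_admissible_some [DecidableEq ℚ] {x y : ℚ}
    (hP : (kramerCurveA (P.bigM : ℚ)).toAffine.Nonsingular x y) :
    ∃ d₁ d₂ d₃ : ℚ, Admissible P d₁ d₂ d₃ ∧
      Point.twoDescentComponent (kramerCurveA (P.bigM : ℚ)).toAffine 0 (-(4 * (P.bigM : ℚ)))
        (-(16 * (P.bigM : ℚ) + 1) / 4) (Point.some x y hP) = sqClass d₁ ∧
      Point.twoDescentComponent (kramerCurveA (P.bigM : ℚ)).toAffine (-(4 * (P.bigM : ℚ))) 0
        (-(16 * (P.bigM : ℚ) + 1) / 4) (Point.some x y hP) = sqClass d₂ := by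
  obtain ⟨h2m, h2l, h24⟩ := padicValRat_two_consts P
  -- the integer `m` and the equation with integral coefficients
  set m : ℤ := (P.bigM : ℤ) with hmdef
  have hmq : ((m : ℤ) : ℚ) = (P.bigM : ℚ) := Int.cast_natCast _
  have hm0 : m ≠ 0 := P.bigM_ne_zero
  have hm0' : (P.bigM : ℚ) ≠ 0 := by exact_mod_cast P.bigM_pos.ne'
  have hmpos : (0 : ℚ) < (P.bigM : ℚ) := by exact_mod_cast P.bigM_pos
  have hmodd : Odd m := odd_bigM_int P
  have hl0 : (16 * (P.bigM : ℚ) + 1) ≠ 0 := by positivity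
  have hlpos : (0 : ℚ) < 16 * (P.bigM : ℚ) + 1 := by positivity
  have heqQ := (curveA_equation_iff (P.bigM : ℚ) x y).mp hP.1
  have heq : y ^ 2 + x * y = x ^ 3 + 8 * (m : ℚ) * x ^ 2 + (m : ℚ) * (16 * (m : ℚ) + 1) * x := by
    rw [hmq]; exact heqQ
  -- case distinction on `x`
  by_cases hx0 : x = 0
  · -- `T₁ = (0, 0)`: triple `(mℓ, 4m, ℓ)` (written to match the convention value at `T₁`)
    subst hx0
    refine ⟨4 * (P.bigM : ℚ) * ((16 * (P.bigM : ℚ) + 1) / 4), 4 * (P.bigM : ℚ),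
      16 * (P.bigM : ℚ) + 1, ?_, ?_, ?_⟩
    · refine ⟨by positivity, by positivity, hl0, ⟨2 * (P.bigM : ℚ) * (16 * (P.bigM : ℚ) + 1), by ring⟩,
        ?_, ?_, ?_, hlpos, by positivity⟩
      · intro p hp hL hM
        haveI : Fact p.Prime := ⟨hp⟩
        by_cases hp2 : p = 2
        · subst hp2
          refine ⟨?_, ?_, ⟨0, by rw [h2l]; rfl⟩⟩
          · rw [show 4 * (P.bigM : ℚ) * ((16 * (P.bigM : ℚ) + 1) / 4) =
                (P.bigM : ℚ) * (16 * (P.bigM : ℚ) + 1) by ring,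
              padicValRat.mul hm0' hl0, h2m, h2l]; exact ⟨0, rfl⟩
          · rw [padicValRat.mul (by norm_num) hm0', h24, h2m]; exact ⟨1, rfl⟩
        · obtain ⟨hvm, hvl, hv4⟩ := padicValRat_consts_of_not_mem P hp2 hL hM
          refine ⟨?_, ?_, ⟨0, by rw [hvl]; rfl⟩⟩
          · rw [show 4 * (P.bigM : ℚ) * ((16 * (P.bigM : ℚ) + 1) / 4) =
                (P.bigM : ℚ) * (16 * (P.bigM : ℚ) + 1) by ring,
              padicValRat.mul hm0' hl0, hvm, hvl]; exact ⟨0, rfl⟩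
          · rw [padicValRat.mul (by norm_num) hm0', hv4, hvm]; exact ⟨0, rfl⟩
      · intro p hp
        haveI : Fact p.Prime := ⟨P.prime_of_mem_primesL hp⟩
        obtain ⟨hdvd, h4⟩ := dvd_of_mem_primesL P hp
        have := padicSqLike_x_add_four_mul hdvd h4 heq (by rw [zero_add, hmq]; positivity)
        rwa [zero_add, hmq] at this
      · intro q hq
        haveI : Fact q.Prime := ⟨P.prime_of_mem_primesM hq⟩
        have := padicSqLike_l (dvd_of_mem_primesM P hq).1 hm0
        rwa [hmq] at this
    · rw [Point.twoDescentComponent_some_of_eq hP rfl]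
      congr 1; ring
    · rw [Point.twoDescentComponent_some_of_ne hP (by
        intro h; have : (4 * (P.bigM : ℚ)) = 0 := by linear_combination h
        exact absurd this (by positivity))]
      congr 1; ring
  by_cases hx2 : x = -(4 * (P.bigM : ℚ))
  · -- `T₂ = (-4m, 2m)`: triple `(-4m, -m, 1)`
    refine ⟨-(4 * (P.bigM : ℚ)), -(P.bigM : ℚ), 1, ?_, ?_, ?_⟩
    · refine ⟨neg_ne_zero.mpr (by positivity), neg_ne_zero.mpr hm0', one_ne_zero,
        ⟨2 * (P.bigM : ℚ), by ring⟩, ?_, ?_, ?_, one_pos, by nlinarith⟩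
      · intro p hp hL hM
        haveI : Fact p.Prime := ⟨hp⟩
        refine ⟨?_, ?_, ⟨0, by rw [padicValRat.one]; rfl⟩⟩
        · rw [padicValRat.neg, padicValRat.mul (by norm_num) hm0']
          by_cases hp2 : p = 2
          · subst hp2; rw [h24, h2m]; exact ⟨1, rfl⟩
          · obtain ⟨hvm, -, hv4⟩ := padicValRat_consts_of_not_mem P hp2 hL hM
            rw [hv4, hvm]; exact ⟨0, rfl⟩
        · rw [padicValRat.neg]
          by_cases hp2 : p = 2
          · subst hp2; rw [h2m]; exact ⟨0, rfl⟩
          · obtain ⟨hvm, -, -⟩ := padicValRat_consts_of_not_mem P hp2 hL hM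
            rw [hvm]; exact ⟨0, rfl⟩
      · intro p hp
        haveI : Fact p.Prime := ⟨P.prime_of_mem_primesL hp⟩
        have := padicSqLike_neg_m (dvd_of_mem_primesL P hp).1
        rwa [hmq] at this
      · intro q _
        exact padicSqLike_one q
    · rw [Point.twoDescentComponent_some_of_ne hP hx0, sub_zero, hx2]
    · rw [Point.twoDescentComponent_some_of_eq hP hx2]
      congr 1; ring
  by_cases hx3 : x = -((16 * (P.bigM : ℚ) + 1) / 4)
  · -- `T₃ = (-ℓ/4, ℓ/8)`: triple `(-ℓ/4, -1/4, ℓ)`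
    have hd2 : x + 4 * (P.bigM : ℚ) = -(1 / 4) := by rw [hx3]; ring
    refine ⟨x, -(1 / 4), 16 * (P.bigM : ℚ) + 1, ?_, ?_, ?_⟩
    · refine ⟨hx0, by norm_num, hl0, ⟨(16 * (P.bigM : ℚ) + 1) / 4, by rw [hx3]; ring⟩, ?_, ?_, ?_,
        hlpos, by rw [hx3, neg_mul_neg]; positivity⟩
      · intro p hp hL hM
        haveI : Fact p.Prime := ⟨hp⟩
        by_cases hp2 : p = 2
        · subst hp2
          refine ⟨⟨-1, ?_⟩, ⟨-1, ?_⟩, ⟨0, by rw [h2l]; rfl⟩⟩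
          · rw [hx3, padicValRat.neg, padicValRat.div hl0 (by norm_num), h2l, h24]; rfl
          · rw [padicValRat.neg, padicValRat.div one_ne_zero (by norm_num), padicValRat.one, h24]; rfl
        · obtain ⟨-, hvl, hv4⟩ := padicValRat_consts_of_not_mem P hp2 hL hM
          refine ⟨⟨0, ?_⟩, ⟨0, ?_⟩, ⟨0, by rw [hvl]; rfl⟩⟩
          · rw [hx3, padicValRat.neg, padicValRat.div hl0 (by norm_num), hvl, hv4]; rfl
          · rw [padicValRat.neg, padicValRat.div one_ne_zero (by norm_num), padicValRat.one, hv4]; rfl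
      · intro p hp
        haveI : Fact p.Prime := ⟨P.prime_of_mem_primesL hp⟩
        obtain ⟨hdvd, h4⟩ := dvd_of_mem_primesL P hp
        have := padicSqLike_x_add_four_mul hdvd h4 heq (by rw [hmq, hd2]; norm_num)
        rwa [hmq, hd2] at this
      · intro q hq
        haveI : Fact q.Prime := ⟨P.prime_of_mem_primesM hq⟩
        have := padicSqLike_l (dvd_of_mem_primesM P hq).1 hm0
        rwa [hmq] at this
    · rw [Point.twoDescentComponent_some_of_ne hP hx0, sub_zero]
    · rw [Point.twoDescentComponent_some_of_ne hP hx2, sub_neg_eq_add, hd2]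
  · -- generic point: triple `(x, x + 4m, x + ℓ/4)`
    have h₂ : x + 4 * (P.bigM : ℚ) ≠ 0 := fun h => hx2 (by linear_combination h)
    have h₃ : x + (16 * (P.bigM : ℚ) + 1) / 4 ≠ 0 := fun h => hx3 (by linear_combination h)
    obtain ⟨hpos3, hnonneg⟩ := descentTriple_pos hmpos heqQ h₃
    refine ⟨x, x + 4 * (P.bigM : ℚ), x + (16 * (P.bigM : ℚ) + 1) / 4, ?_, ?_, ?_⟩
    · refine ⟨hx0, h₂, h₃, ⟨y + x / 2, sq_eq_descentTriple heqQ⟩, ?_, ?_, ?_, hpos3, hnonneg⟩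
      · intro p hp hL hM
        haveI : Fact p.Prime := ⟨hp⟩
        by_cases hp2 : p = 2
        · subst hp2
          have := even_padicValRat_two hmodd heq hx0 (by rwa [hmq]) (by rwa [hmq])
          rwa [hmq] at this
        · obtain ⟨hm, hl⟩ := not_dvd_of_not_mem P hp hL hM
          have := even_padicValRat_odd_good hp2 hm hl heq hx0 (by rwa [hmq]) (by rwa [hmq])
          rwa [hmq] at this
      · intro p hp
        haveI : Fact p.Prime := ⟨P.prime_of_mem_primesL hp⟩
        obtain ⟨hdvd, h4⟩ := dvd_of_mem_primesL P hp
        have := padicSqLike_x_add_four_mul hdvd h4 heq (by rwa [hmq])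
        rwa [hmq] at this
      · intro q hq
        haveI : Fact q.Prime := ⟨P.prime_of_mem_primesM hq⟩
        have := padicSqLike_x_add_l_div_four (dvd_of_mem_primesM P hq).1 hm0
          (dvd_of_mem_primesM P hq).2 heq (by rwa [hmq])
        rwa [hmq] at this
    · rw [Point.twoDescentComponent_some_of_ne hP hx0, sub_zero]
    · rw [Point.twoDescentComponent_some_of_ne hP hx2, sub_neg_eq_add]

/-- Every rational point of `A` (including `O`) has an admissible descent triple representing
`(γ(P), γ₂(P))`. [cite: Kramer1983, Lemma 2 and §5 (p. 383)] -/
theorem exists_admissible [DecidableEq ℚ] (Pt : (kramerCurveA (P.bigM : ℚ)).toAffine.Point) :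
    ∃ d₁ d₂ d₃ : ℚ, Admissible P d₁ d₂ d₃ ∧
      Point.twoDescentComponent (kramerCurveA (P.bigM : ℚ)).toAffine 0 (-(4 * (P.bigM : ℚ)))
        (-(16 * (P.bigM : ℚ) + 1) / 4) Pt = sqClass d₁ ∧
      Point.twoDescentComponent (kramerCurveA (P.bigM : ℚ)).toAffine (-(4 * (P.bigM : ℚ))) 0
        (-(16 * (P.bigM : ℚ) + 1) / 4) Pt = sqClass d₂ := by
  rcases Pt with _ | ⟨x, y, hP⟩
  · refine ⟨1, 1, 1, admissible_one P, ?_, ?_⟩ <;>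
    · rw [← one_pow 2, sqClass_sq]; rfl
  · exact exists_admissible_some hP

end PointsAdmissible

/-! ### Valuations and signs of the span integers `a(e)`, `b(e)`, `c(e)` -/

section SpanIntegers

/-- The two elements of `ℤ/2`. [folklore] -/
theorem zmod_two_cases (x : ZMod 2) : x = 0 ∨ x = 1 := by
  revert x; decide

/-- `x + x = 0` in `ℤ/2`. [folklore] -/
theorem zmod_two_add_self (x : ZMod 2) : x + x = 0 := by
  revert x; decide

/-- `a + b = 0` in `ℤ/2` forces `a = b`. [folklore] -/
theorem zmod_two_eq_of_add_eq_zero {a b : ZMod 2} (h : a + b = 0) : a = b := by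
  revert a b; decide

/-- The sign bit of `(-1)^{x} c` for `c > 0` is `x`. [folklore] -/
theorem signBit_neg_one_pow_mul (x : ZMod 2) {c : ℚ} (hc : 0 < c) :
    signBit ((-1 : ℚ) ^ x.val * c) = x := by
  rcases zmod_two_cases x with rfl | rfl
  · rw [ZMod.val_zero, pow_zero, one_mul, (signBit_eq_zero_iff hc.ne').mpr hc]
  · rw [ZMod.val_one, pow_one, neg_one_mul, signBit, if_pos (neg_neg_of_pos hc)]

/-- The valuation of a product `∏_{q ∈ 𝔏 ∪ 𝔐} q^{k(q)}` restricted to a subset `T`: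
`v_p = k(p)` if `p ∈ T`, else `0`. [folklore] -/
theorem padicValRat_prod_ite_pow (T : Finset ℕ) (k : ↥P.badPrimes → ℕ) (p : ℕ) [Fact p.Prime] :
    padicValRat p (∏ q : ↥P.badPrimes,
        (if (q : ℕ) ∈ T then ((q : ℕ) : ℚ) ^ k q else 1)) =
      if h : p ∈ P.badPrimes ∧ p ∈ T then (k ⟨p, h.1⟩ : ℤ) else 0 := by
  have hq0 : ∀ q : ↥P.badPrimes, (if (q : ℕ) ∈ T then ((q : ℕ) : ℚ) ^ k q else 1) ≠ 0 := by
    intro q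
    split_ifs
    · exact pow_ne_zero _ (Nat.cast_ne_zero.mpr (P.prime_of_mem_badPrimes q.2).ne_zero)
    · exact one_ne_zero
  have hterm : ∀ q : ↥P.badPrimes, padicValRat p (if (q : ℕ) ∈ T then ((q : ℕ) : ℚ) ^ k q else 1) =
      if (q : ℕ) = p ∧ (q : ℕ) ∈ T then (k q : ℤ) else 0 := by
    intro q
    haveI : Fact (q : ℕ).Prime := ⟨P.prime_of_mem_badPrimes q.2⟩
    by_cases hT : (q : ℕ) ∈ T
    · rw [if_pos hT, padicValRat.pow, padicValRat.of_nat]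
      by_cases hqp : (q : ℕ) = p
      · rw [if_pos ⟨hqp, hT⟩, hqp, padicValNat_self]; push_cast; ring
      · rw [if_neg (fun h => hqp h.1), padicValNat_primes (Ne.symm hqp)]; push_cast; ring
    · rw [if_neg hT, padicValRat.one, if_neg (fun h => hT h.2)]
  rw [KramerParams.padicValRat_finset_prod _ _ (fun q _ => hq0 q)]
  simp_rw [hterm]
  by_cases h : p ∈ P.badPrimes ∧ p ∈ T
  · rw [dif_pos h, Finset.sum_eq_single (⟨p, h.1⟩ : ↥P.badPrimes)]
    · rw [if_pos ⟨rfl, h.2⟩]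
    · intro q _ hq
      rw [if_neg]
      rintro ⟨hqp, -⟩
      exact hq (Subtype.ext hqp)
    · intro habs; exact absurd (Finset.mem_univ _) habs
  · rw [dif_neg h]
    refine Finset.sum_eq_zero fun q _ => ?_
    rw [if_neg]
    rintro ⟨hqp, hT⟩
    exact h ⟨hqp ▸ q.2, hqp ▸ hT⟩

/-- `v_p(a(e)) = e(p)` for `p ∈ 𝔏 ∪ 𝔐`, `0` otherwise. [cite: Kramer1983, proof of the Theorem (§5), p. 383] -/
theorem padicValRat_spanFst (e : P.Expo) (p : ℕ) [Fact p.Prime] :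
    padicValRat p ((P.spanFst e : ℤ) : ℚ) =
      if h : p ∈ P.badPrimes then ((e.2 ⟨p, h⟩).val : ℤ) else 0 := by
  have hprod := padicValRat_prod_ite_pow P P.badPrimes (fun q => (e.2 q).val) p
  simp only [Finset.coe_mem, if_true] at hprod
  unfold KramerParams.spanFst
  push_cast
  rw [padicValRat.mul (pow_ne_zero _ (by norm_num)) (Finset.prod_ne_zero_iff.mpr fun q _ =>
      pow_ne_zero _ (Nat.cast_ne_zero.mpr (P.prime_of_mem_badPrimes q.2).ne_zero)),
    padicValRat.pow, padicValRat.neg, padicValRat.one, mul_zero, zero_add, hprod]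
  by_cases h : p ∈ P.badPrimes
  · rw [dif_pos ⟨h, h⟩, dif_pos h]
  · rw [dif_neg (fun h' => h h'.1), dif_neg h]

/-- `v_p(b(e)) = e(p)` for `p ∈ 𝔐`, `0` otherwise. [cite: Kramer1983, proof of the Theorem (§5), p. 383 (a_p)] -/
theorem padicValRat_spanSnd (e : P.Expo) (p : ℕ) [Fact p.Prime] :
    padicValRat p ((P.spanSnd e : ℤ) : ℚ) =
      if h : p ∈ P.primesM then ((e.2 ⟨p, Finset.mem_union_right _ h⟩).val : ℤ) else 0 := by
  have hprod := padicValRat_prod_ite_pow P P.primesM (fun q => (e.2 q).val) p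
  unfold KramerParams.spanSnd
  push_cast
  rw [padicValRat.mul (pow_ne_zero _ (by norm_num)) (Finset.prod_ne_zero_iff.mpr fun q _ => by
      split_ifs
      · exact pow_ne_zero _ (Nat.cast_ne_zero.mpr (P.prime_of_mem_badPrimes q.2).ne_zero)
      · exact one_ne_zero),
    padicValRat.pow, padicValRat.neg, padicValRat.one, mul_zero, zero_add, hprod]
  by_cases h : p ∈ P.primesM
  · rw [dif_pos ⟨Finset.mem_union_right _ h, h⟩, dif_pos h]
  · rw [dif_neg (fun h' => h h'.2), dif_neg h]

/-- `v_p(c(e)) = e(p)` for `p ∈ 𝔏`, `0` otherwise. [cite: Kramer1983, proof of the Theorem (§5), p. 383 (b_q)] -/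
theorem padicValRat_spanL (e : P.Expo) (p : ℕ) [Fact p.Prime] :
    padicValRat p ((P.spanL e : ℤ) : ℚ) =
      if h : p ∈ P.primesL then ((e.2 ⟨p, Finset.mem_union_left _ h⟩).val : ℤ) else 0 := by
  have hprod := padicValRat_prod_ite_pow P P.primesL (fun q => (e.2 q).val) p
  unfold KramerParams.spanL
  push_cast
  rw [hprod]
  by_cases h : p ∈ P.primesL
  · rw [dif_pos ⟨Finset.mem_union_left _ h, h⟩, dif_pos h]
  · rw [dif_neg (fun h' => h h'.2), dif_neg h]

/-- `a(e) = (-1)^{e(∞)} · (positive)`: its sign bit is `e(∞)`. [folklore] -/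
theorem signBit_spanFst (e : P.Expo) : signBit ((P.spanFst e : ℤ) : ℚ) = e.1 := by
  unfold KramerParams.spanFst
  push_cast
  exact signBit_neg_one_pow_mul e.1 (Finset.prod_pos fun q _ =>
    pow_pos (Nat.cast_pos.mpr (P.prime_of_mem_badPrimes q.2).pos) _)

/-- `b(e) = (-1)^{e(∞)} · (positive)`: its sign bit is `e(∞)`. [folklore] -/
theorem signBit_spanSnd (e : P.Expo) : signBit ((P.spanSnd e : ℤ) : ℚ) = e.1 := by
  unfold KramerParams.spanSnd
  push_cast
  refine signBit_neg_one_pow_mul e.1 (Finset.prod_pos fun q _ => ?_)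
  split_ifs
  · exact pow_pos (Nat.cast_pos.mpr (P.prime_of_mem_badPrimes q.2).pos) _
  · exact one_pos

/-- `c(e) > 0`. [folklore] -/
theorem spanL_pos (e : P.Expo) : (0 : ℚ) < ((P.spanL e : ℤ) : ℚ) := by
  unfold KramerParams.spanL
  push_cast
  refine Finset.prod_pos fun q _ => ?_
  split_ifs
  · exact pow_pos (Nat.cast_pos.mpr (P.prime_of_mem_badPrimes q.2).pos) _
  · exact one_pos

end SpanIntegers

/-! ### Square classes with prescribed sign and parities -/

section SqClassEq

/-- Two non-zero rationals with positive product and even sum of valuations at every prime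
have the same square class. [folklore] -/
theorem sqClass_eq_of_even {a b : ℚ} (ha : a ≠ 0) (hb : b ≠ 0) (hpos : 0 < a * b)
    (h : ∀ p : ℕ, p.Prime → Even (padicValRat p a + padicValRat p b)) : sqClass a = sqClass b := by
  obtain ⟨r, hr⟩ := exists_sq_of_even_padicValRat hpos fun p hp => by
    haveI : Fact p.Prime := ⟨hp⟩
    rw [padicValRat.mul ha hb]; exact h p hp
  have hab : sqClass a * sqClass b = 1 := by
    rw [← sqClass_mul ha hb, hr, sqClass_sq]
  rw [SqUnits.eq_mul_of_mul_eq hab, SqUnits.one_mul]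

/-- Equal square classes: `a = b r²`. [folklore] -/
theorem exists_eq_mul_sq_of_sqClass_eq {a b : ℚ} (ha : a ≠ 0) (hb : b ≠ 0)
    (h : sqClass a = sqClass b) : ∃ r : ℚ, a = b * r ^ 2 := by
  have hab : sqClass (a * b) = 1 := by rw [sqClass_mul ha hb, h, SqUnits.mul_self]
  obtain ⟨s, hs⟩ := (sqClass_eq_one_iff (mul_ne_zero ha hb)).mp hab
  exact ⟨s / b, by field_simp; linear_combination hs⟩

/-- From `v = 0` for a non-zero integer: `p ∤ M`. [folklore] -/
theorem not_dvd_of_padicValRat_eq_zero {p : ℕ} [Fact p.Prime] {M : ℤ} (hM : M ≠ 0)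
    (hv : padicValRat p (M : ℚ) = 0) : ¬ (p : ℤ) ∣ M := by
  intro hd
  rcases padicValRat_intCast_of_dvd (p := p) hd with h0 | h1
  · exact hM (by exact_mod_cast h0)
  · omega

end SqClassEq

/-! ### The exponent vector of a rational point and the leaf -/

section Leaf

variable {P}

/-- The parity `v_p(d) mod 2`, read in `{0, 1}`, makes `v_p(d) + (v_p(d) mod 2)` even. [folklore] -/
theorem even_add_val_parityBit (p : ℕ) (d : ℚ) :
    Even (padicValRat p d + ((parityBit p d).val : ℤ)) := by
  unfold parityBit
  rw [ZMod.val_intCast]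
  rcases Int.even_or_odd (padicValRat p d) with ⟨k, hk⟩ | ⟨k, hk⟩
  · exact ⟨k, by omega⟩
  · exact ⟨k + 1, by omega⟩

/-- **The exponent vector of an admissible triple.** For an admissible `(d₁, d₂, d₃)` let
`e = (sign d₁; v_p(d₁) mod 2)_{p ∈ 𝔏 ∪ 𝔐}`. Then `[d₁] = [a(e)]`, `[d₂] = [b(e)]`
(`d₂` has the sign of `d₁`, even valuation at `𝔏` by `(iv)`, and `v_q(d₂) ≡ v_q(d₁)` at
`q ∈ 𝔐` because `v_q(d₃)` is even by `(iii)`), and `e` satisfies `(a_p)` for all `p ∈ 𝔏`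
and `(b_q)` for all `q ∈ 𝔐`: `d₂ = b(e) r²` is a first-order `p`-adic square, so
`(b(e)/p) = 1`; `d₃ = c(e) r′²` is a first-order `q`-adic square, so `(c(e)/q) = 1`
("for an element … to represent a coset in `S(A/2A)` it is necessary … that `(a_p)`, `(b_q)`
hold", p. 383). [cite: Kramer1983, proof of the Theorem (§5), pp. 383–384] -/
theorem Admissible.exists_expo {d₁ d₂ d₃ : ℚ} (hA : Admissible P d₁ d₂ d₃) :
    ∃ e : P.Expo, P.CondA e ∧ P.CondB e ∧
      sqClass d₁ = sqClass ((P.spanFst e : ℤ) : ℚ) ∧ sqClass d₂ = sqClass ((P.spanSnd e : ℤ) : ℚ) := by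
  obtain ⟨z, hz⟩ := hA.sq
  have hsum : ∀ p : ℕ, [Fact p.Prime] →
      Even (padicValRat p d₁ + padicValRat p d₂ + padicValRat p d₃) :=
    fun p _ => even_sum_padicValRat_of_sq hz hA.ne₁ hA.ne₂ hA.ne₃
  let e : P.Expo := (signBit d₁, fun p => parityBit p d₁)
  have he1 : e.1 = signBit d₁ := rfl
  have he2 : ∀ p : ↥P.badPrimes, e.2 p = parityBit p d₁ := fun p => rfl
  have hF0 : ((P.spanFst e : ℤ) : ℚ) ≠ 0 := Int.cast_ne_zero.mpr (P.spanFst_ne_zero e)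
  have hSpos : ∀ q : ↥P.badPrimes, (0 : ℚ) < ((q : ℕ) : ℚ) := fun q =>
    Nat.cast_pos.mpr (P.prime_of_mem_badPrimes q.2).pos
  have hS0' : P.spanSnd e ≠ 0 := by
    unfold KramerParams.spanSnd
    exact mul_ne_zero (pow_ne_zero _ (by norm_num)) (Finset.prod_ne_zero_iff.mpr fun q _ => by
      split_ifs
      · exact pow_ne_zero _ (Int.natCast_ne_zero.mpr (P.prime_of_mem_badPrimes q.2).ne_zero)
      · exact one_ne_zero)
  have hS0 : ((P.spanSnd e : ℤ) : ℚ) ≠ 0 := Int.cast_ne_zero.mpr hS0'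
  have hL0' : P.spanL e ≠ 0 := fun h0 => (spanL_pos P e).ne' (by rw [h0, Int.cast_zero])
  have hL0 : ((P.spanL e : ℤ) : ℚ) ≠ 0 := (spanL_pos P e).ne'
  -- signs: `d₁ a(e) > 0`, `d₂ b(e) > 0`
  have hsign1 : 0 < d₁ * ((P.spanFst e : ℤ) : ℚ) := by
    rw [← signBit_eq_zero_iff (mul_ne_zero hA.ne₁ hF0), signBit_mul hA.ne₁ hF0, signBit_spanFst,
      he1]
    exact zmod_two_add_self _
  have hs12 : signBit d₁ = signBit d₂ := by
    have h := lt_of_le_of_ne hA.nonneg₁₂ (Ne.symm (mul_ne_zero hA.ne₁ hA.ne₂))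
    rw [← signBit_eq_zero_iff (mul_ne_zero hA.ne₁ hA.ne₂), signBit_mul hA.ne₁ hA.ne₂] at h
    exact zmod_two_eq_of_add_eq_zero h
  have hsign2 : 0 < d₂ * ((P.spanSnd e : ℤ) : ℚ) := by
    rw [← signBit_eq_zero_iff (mul_ne_zero hA.ne₂ hS0), signBit_mul hA.ne₂ hS0, signBit_spanSnd,
      he1, ← hs12]
    exact zmod_two_add_self _
  -- E1: `[d₁] = [a(e)]`
  have hE1 : sqClass d₁ = sqClass ((P.spanFst e : ℤ) : ℚ) := by
    refine sqClass_eq_of_even hA.ne₁ hF0 hsign1 fun p hp => ?_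
    haveI : Fact p.Prime := ⟨hp⟩
    rw [padicValRat_spanFst]
    by_cases h : p ∈ P.badPrimes
    · rw [dif_pos h, he2]
      exact even_add_val_parityBit p d₁
    · rw [dif_neg h, add_zero]
      rw [KramerParams.badPrimes, Finset.mem_union, not_or] at h
      exact (hA.even_of_not_mem p hp h.1 h.2).1
  -- E2: `[d₂] = [b(e)]`
  have hE2 : sqClass d₂ = sqClass ((P.spanSnd e : ℤ) : ℚ) := by
    refine sqClass_eq_of_even hA.ne₂ hS0 hsign2 fun p hp => ?_
    haveI : Fact p.Prime := ⟨hp⟩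
    rw [padicValRat_spanSnd]
    by_cases h : p ∈ P.primesM
    · rw [dif_pos h, he2]
      dsimp only
      obtain ⟨a, ha⟩ := even_add_val_parityBit p d₁
      obtain ⟨b, hb⟩ := (hA.sqLike₃ p h).even_padicValRat hA.ne₃
      obtain ⟨c, hc⟩ := hsum p
      exact ⟨c - a - b + ((parityBit p d₁).val : ℤ), by omega⟩
    · rw [dif_neg h, add_zero]
      by_cases hL : p ∈ P.primesL
      · exact (hA.sqLike₂ p hL).even_padicValRat hA.ne₂
      · exact (hA.even_of_not_mem p hp hL h).2.1
  -- `[d₃] = [c(e)]`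
  have hE3 : sqClass d₃ = sqClass ((P.spanL e : ℤ) : ℚ) := by
    refine sqClass_eq_of_even hA.ne₃ hL0 (mul_pos hA.pos₃ (spanL_pos P e)) fun p hp => ?_
    haveI : Fact p.Prime := ⟨hp⟩
    rw [padicValRat_spanL]
    by_cases h : p ∈ P.primesL
    · rw [dif_pos h, he2]
      dsimp only
      obtain ⟨a, ha⟩ := even_add_val_parityBit p d₁
      obtain ⟨b, hb⟩ := (hA.sqLike₂ p h).even_padicValRat hA.ne₂
      obtain ⟨c, hc⟩ := hsum p
      exact ⟨c - a - b + ((parityBit p d₁).val : ℤ), by omega⟩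
    · rw [dif_neg h, add_zero]
      by_cases hM : p ∈ P.primesM
      · exact (hA.sqLike₃ p hM).even_padicValRat hA.ne₃
      · exact (hA.even_of_not_mem p hp h hM).2.2
  refine ⟨e, ?_, ?_, hE1, hE2⟩
  · -- (a_p) for `p ∈ 𝔏`
    intro p hp
    haveI : Fact p.Prime := ⟨P.prime_of_mem_primesL hp⟩
    obtain ⟨r, hr⟩ := exists_eq_mul_sq_of_sqClass_eq hA.ne₂ hS0 hE2
    have hr0 : r ≠ 0 := by rintro rfl; apply hA.ne₂; rw [hr]; ring
    have hv : padicValRat p ((P.spanSnd e : ℤ) : ℚ) = 0 := by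
      rw [padicValRat_spanSnd, dif_neg (P.not_mem_primesM_of_mem_primesL hp)]
    have hsq : PadicSqLike p (((P.spanSnd e : ℤ) : ℚ) * r ^ 2) := hr ▸ hA.sqLike₂ p hp
    have h1 := legendreSym_eq_one_of_padicSqLike (not_dvd_of_padicValRat_eq_zero hS0' hv) hr0 hsq
    rwa [jacobiSym.legendreSym.to_jacobiSym] at h1
  · -- (b_q) for `q ∈ 𝔐`
    intro q hq
    haveI : Fact q.Prime := ⟨P.prime_of_mem_primesM hq⟩
    obtain ⟨r, hr⟩ := exists_eq_mul_sq_of_sqClass_eq hA.ne₃ hL0 hE3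
    have hr0 : r ≠ 0 := by rintro rfl; apply hA.ne₃; rw [hr]; ring
    have hv : padicValRat q ((P.spanL e : ℤ) : ℚ) = 0 := by
      rw [padicValRat_spanL, dif_neg (P.not_mem_primesL_of_mem_primesM hq)]
    have hsq : PadicSqLike q (((P.spanL e : ℤ) : ℚ) * r ^ 2) := hr ▸ hA.sqLike₃ q hq
    have h1 := legendreSym_eq_one_of_padicSqLike (not_dvd_of_padicValRat_eq_zero hL0' hv) hr0 hsq
    rwa [jacobiSym.legendreSym.to_jacobiSym] at h1

/-- **Every rational point of `A` is represented by a span element satisfying `(a_p)`,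
`(b_q)`** (instance-polymorphic form of the leaf, for the fixed parameters `P`).
[cite: Kramer1983, §5 (7), Lemma 2 and proof of the Theorem pp. 383–384] -/
theorem selmerTwo_span_point [DecidableEq ℚ] (Pt : (kramerCurveA (P.bigM : ℚ)).toAffine.Point) :
    ∃ e : P.Expo, P.CondA e ∧ P.CondB e ∧
      Point.twoDescentComponent (kramerCurveA (P.bigM : ℚ)).toAffine 0 (-(4 * (P.bigM : ℚ)))
        (-(16 * (P.bigM : ℚ) + 1) / 4) Pt = sqClass ((P.spanFst e : ℤ) : ℚ) ∧
      Point.twoDescentComponent (kramerCurveA (P.bigM : ℚ)).toAffine (-(4 * (P.bigM : ℚ))) 0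
        (-(16 * (P.bigM : ℚ) + 1) / 4) Pt = sqClass ((P.spanSnd e : ℤ) : ℚ) := by
  obtain ⟨d₁, d₂, d₃, hA, h1, h2⟩ := exists_admissible Pt
  obtain ⟨e, hCA, hCB, he1, he2⟩ := hA.exists_expo
  exact ⟨e, hCA, hCB, h1.trans he1, h2.trans he2⟩


/-- **Kramer's rank bound, unconditionally**: `#(A(ℚ)/2A(ℚ)) · 4ⁿ ≤ 2^{|𝔏 ∪ 𝔐| + 1}`, i.e.
`rank A(ℚ) + 2 = dim A(ℚ)/2A(ℚ) ≤ |𝔏| + |𝔐| + 1 - 2n` ("Hence `dim S(A/2A) ≤ |𝔐|+|𝔏|+1-2n`",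
p. 384, for the subgroup `A(ℚ)/2A(ℚ) ↪ S(A/2A)` of (7)): the complete `2`-descent `λ` has
kernel `2A(ℚ)` (Silverman X.1.4, tree `ker_twoDescentMap`), its image is parametrised by
exponent vectors satisfying `(a_p)`, `(b_q)` (`selmerTwo_span_point`, the `a(e)` being
independent, `KramerParams.sqClass_spanFst_injective`), and these number
`≤ 2^{|𝔏∪𝔐|+1}/4ⁿ` (`KramerParams.card_cond_mul_le`). In particular `A(ℚ)/2A(ℚ)` is finite
(weak Mordell–Weil for the family, with an explicit bound).
[cite: Kramer1983, §5 (7)–(8) and proof of the Theorem, p. 384] -/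
theorem card_quotient_two_mul_le (P : KramerParams n) :
    Nat.card ((kramerCurveA (P.bigM : ℚ)).toAffine.Point ⧸
        (nsmulAddMonoidHom 2 : (kramerCurveA (P.bigM : ℚ)).toAffine.Point →+
          (kramerCurveA (P.bigM : ℚ)).toAffine.Point).range) * 4 ^ n
      ≤ 2 ^ (P.badPrimes.card + 1) := by
  classical
  haveI := P.isElliptic_kramerCurveA
  have hs := splitTwoTorsion_kramerCurveA (P.bigM : ℚ)
  have hker := Point.ker_twoDescentMap hs
  have key : ∀ y : (Point.twoDescentMap hs).range, ∃ e : {e : P.Expo // P.CondA e ∧ P.CondB e},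
      (y : Additive (SqUnits ℚ × SqUnits ℚ)) =
        Additive.ofMul (sqClass ((P.spanFst e.1 : ℤ) : ℚ), sqClass ((P.spanSnd e.1 : ℤ) : ℚ)) := by
    rintro ⟨_, Pt, rfl⟩
    obtain ⟨e, hA, hB, h1, h2⟩ := selmerTwo_span_point (P := P) Pt
    refine ⟨⟨e, hA, hB⟩, ?_⟩
    show Point.twoDescentMap hs Pt = _
    rw [Point.twoDescentMap_apply, h1, h2]
  choose f hf using key
  have hinj : Function.Injective f := by
    intro y₁ y₂ h
    apply Subtype.ext
    rw [hf y₁, hf y₂, h]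
  have h1 : Nat.card ((kramerCurveA (P.bigM : ℚ)).toAffine.Point ⧸
      (nsmulAddMonoidHom 2 : (kramerCurveA (P.bigM : ℚ)).toAffine.Point →+
        (kramerCurveA (P.bigM : ℚ)).toAffine.Point).range) =
      Nat.card (Point.twoDescentMap hs).range := by
    rw [← hker]
    exact Nat.card_congr (QuotientAddGroup.quotientKerEquivRange (Point.twoDescentMap hs)).toEquiv
  rw [h1]
  calc Nat.card (Point.twoDescentMap hs).range * 4 ^ n
      ≤ Nat.card {e : P.Expo // P.CondA e ∧ P.CondB e} * 4 ^ n :=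
        Nat.mul_le_mul_right _ (Nat.card_le_card_of_injective f hinj)
    _ = Fintype.card {e : P.Expo // P.CondA e ∧ P.CondB e} * 4 ^ n := by
        rw [Nat.card_eq_fintype_card]
    _ ≤ Fintype.card P.Expo := by convert P.card_cond_mul_le using 2
    _ = 2 ^ (P.badPrimes.card + 1) := P.card_expo

/-- The same bound with `|𝔏 ∪ 𝔐| = |𝔏| + |𝔐|` (the sets are disjoint, `ℓ = 16m + 1`), as printed:
`dim A(ℚ)/2A(ℚ) ≤ |𝔐| + |𝔏| + 1 - 2n`. [cite: Kramer1983, proof of the Theorem (§5), p. 384] -/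
theorem card_quotient_two_mul_le' (P : KramerParams n) :
    Nat.card ((kramerCurveA (P.bigM : ℚ)).toAffine.Point ⧸
        (nsmulAddMonoidHom 2 : (kramerCurveA (P.bigM : ℚ)).toAffine.Point →+
          (kramerCurveA (P.bigM : ℚ)).toAffine.Point).range) * 4 ^ n
      ≤ 2 ^ (P.primesL.card + P.primesM.card + 1) := by
  have h := card_quotient_two_mul_le P
  rwa [KramerParams.badPrimes, Finset.card_union_of_disjoint P.disjoint_primesL_primesM] at h

/-- **Kramer 1983, §5 (7) with Lemma 2 — the leaf `Kramer1983_selmerTwo_span` of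
`KramerDescent.lean`, PROVED**: for every `n ≥ 1`, all parameters (i)–(iv) and every
`P ∈ A(ℚ)`, the two coordinates `(x + t₁, x + t₂)` of `λ_ℚ(P)` (`kramerGamma`, `kramerGamma₂`)
are the classes of `a(e)`, `b(e)` for an exponent vector `e` satisfying `(a_p)` for all
`p ∈ 𝔏` and `(b_q)` for all `q ∈ 𝔐` — by the elementary local analysis of
`KramerTwoDescentValuation`/`KramerTwoDescentLocal` (containment halves of Lemma 2) and the
Legendre-symbol translation `legendreSym_eq_one_of_padicSqLike`. Consequently Kramer's bound
`dim Ш(B, ℚ)₂ ≥ 2n` for the explicit family (`Kramer1983_twoRank_sha_family`) rests on the two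
remaining leaves `Kramer1983_selmerG_generators_local` and `Kramer1983_shaG_of_selmerG` only
(`Kramer1983_twoRank_sha_family_of_local_global`).
[cite: Kramer1983, §5 (7), Lemma 2 and proof of the Theorem (§5), pp. 383–384 ((a_p), (b_q))] -/
theorem Kramer1983_selmerTwo_span_holds : Kramer1983_selmerTwo_span :=
  fun _ _ P Pt => @selmerTwo_span_point _ P (_) Pt

/-- **Kramer's Theorem for the explicit family from the two remaining leaves** (local
generators of `S(A/gB)` and the global map `S(A/gB) → Ш(B, ℚ)_g`), the third leaf being
proved above. [cite: Kramer1983, Theorem (§5)] -/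
theorem Kramer1983_twoRank_sha_family_of_local_global
    (hloc : Literature.NumberTheory.EllipticCurves.Kramer1983_selmerG_generators_local)
    (hglob : Literature.NumberTheory.EllipticCurves.Kramer1983_shaG_of_selmerG) :
    Literature.NumberTheory.EllipticCurves.Kramer1983_twoRank_sha_family :=
  Literature.NumberTheory.EllipticCurves.Kramer1983_twoRank_sha_family_of_leaves hloc hglob
    Kramer1983_selmerTwo_span_holds

end Leaf

end Literature.NumberTheory.EllipticCurves.KramerTwoDescent

end
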